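import Mathlib.Analysis.SpecialFunctions.Pow.Integral
import Mathlib.MeasureTheory.Measure.Haar.NormedSpace
import Mathlib.MeasureTheory.Integral.Prod
import Mathlib.MeasureTheory.Integral.IntervalIntegral.FundThmCalculus
import Summits.AtomisticToContinuum.BoseEinsteinCondensation.Theorems.BECSubharmonicContinuationHarmonicMinorantKernel

/-!
# Route BECSubharmonicContinuation · support `HarmonicMinorant` (stmt-AtomisticToContinuum-9003), IV:
# the dilation identity and Green's identity evaluated

Helper file (pure analysis on `ℝ³`). For `u ∈ C¹(ℝ³)` and `0 < ε ≤ S`: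

* `setIntegral_unitBall_comp_smul` — `∫_{B₁} f(tz) dz = t⁻³ ∫_{B_t} f`;
* `setIntegral_unitBall_sub_eq` — `∫_{B₁}(u(Sz) - u(εz)) dz = ∫_ε^S ∫_{B₁} Du(tz)[z] dz dt`
  (fundamental theorem of calculus along rays and Fubini);
* `setIntegral_mul_truncWeight_eq` — the **layer-cake formula**
  `∫_{B_S} F(y)((max ε |y|)⁻³ - S⁻³) dy = ∫_ε^S 3t⁻⁴ ∫_{B_t} F dt` (Fubini);
* `setIntegral_fderiv_apply_self_mul_truncWeight` — the **dilation identity**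
  `∫_{B_S} Du(y)[y]((max ε |y|)⁻³ - S⁻³) dy = 3(S⁻³∫_{B_S} u - ε⁻³∫_{B_ε} u)`;
* `integral_laplacian_mul_testKernel_eq` — hence, for `u ∈ C²`,
  **`∫ Δu·(N_ε - N_S) = (3/4π)(S⁻³∫_{B_S} u - ε⁻³∫_{B_ε} u) = ⨍_{B_S} u - ⨍_{B_ε} u`**
  (the distributional identity `Δ(N_ε - N_S) = 1_{B_S}/|B_S| - 1_{B_ε}/|B_ε|` tested against
  `u`, proved without boundary integrals).

Notation in the docstrings: `ℝ³ = Space = EuclideanSpace ℝ (Fin 3)`; `N_a(y) = (3m² - |y|²)/(8πm³)`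
with `m = max a |y|` is the potential of the uniform unit charge on `B_a` (written out explicitly in
the statements, no definitions), `n_a(q)` the same profile in the variable `q = |y|²`
(`m = max a √q`), and `K_S(y) = 1/(4π|y|) - (3S² - |y|²)/(8πS³)` the ball kernel.

## References

* D. Gilbarg, N. S. Trudinger, *Elliptic Partial Differential Equations of Second Order*
  (Springer 2001), Thm 2.1 (mean value), (2.10)–(2.17) (Green's identities and representation)
  [GilbargTrudinger2001].
* E. H. Lieb, R. Seiringer, J. P. Solovej, J. Yngvason, *The Mathematics of the Bose Gas and its
  Condensation* (2005), §1.2 (1.17)–(1.19) (one-body density matrix) [LiebSeiringerSolovejYngvason2005].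
-/

noncomputable section

open MeasureTheory Filter Metric Set Function Real InnerProductSpace
open scoped ComplexConjugate Topology RealInnerProductSpace Laplacian

namespace Summit.AtomisticToContinuum.BoseEinsteinCondensation.Theorems

namespace HarmonicMinorant

open Literature.MathematicalPhysics.QuantumManyBody.BoseGas

/-! ### Dilations of the unit ball -/

/-- **Scaling of ball integrals**: `∫_{B₁} f(t z) dz = t⁻³ ∫_{B_t} f(y) dy` for `t > 0`. [folklore] -/
theorem setIntegral_unitBall_comp_smul {F : Type*} [NormedAddCommGroup F] [NormedSpace ℝ F]
    (f : Space → F) {t : ℝ} (ht : 0 < t) :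
    ∫ z in ball (0 : Space) 1, f (t • z) = (t ^ 3)⁻¹ • ∫ y in ball (0 : Space) t, f y := by
  rw [Measure.setIntegral_comp_smul_of_pos volume f (ball (0 : Space) 1) ht, smul_unitBall_of_pos ht,
    finrank_euclideanSpace_fin]

/-- **Fundamental theorem of calculus along rays**: for `u ∈ C¹` and `z ∈ Space`,
`u(S z) - u(ε z) = ∫_ε^S Du(t z)[z] dt`. [folklore] -/
theorem sub_eq_integral_fderiv_smul {u : Space → ℝ} (hu : ContDiff ℝ 1 u) (z : Space) (ε S : ℝ) :
    u (S • z) - u (ε • z) = ∫ t in ε..S, fderiv ℝ u (t • z) z := by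
  have hd : ∀ t : ℝ, HasDerivAt (fun t : ℝ => u (t • z)) (fderiv ℝ u (t • z) z) t := fun t => by
    have h1 : HasDerivAt (fun t : ℝ => t • z) ((1 : ℝ) • z) t := (hasDerivAt_id t).smul_const z
    rw [one_smul] at h1
    exact ((hu.differentiable one_ne_zero) _).hasFDerivAt.comp_hasDerivAt t h1
  have hc : Continuous fun t : ℝ => fderiv ℝ u (t • z) z :=
    ((hu.continuous_fderiv one_ne_zero).comp (continuous_id.smul continuous_const)).clm_apply
      continuous_const
  rw [intervalIntegral.integral_eq_sub_of_hasDerivAt (fun t _ => hd t) (hc.intervalIntegrable _ _)]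

/-- The ray integrand `(z, t) ↦ Du(t z)[z]` is continuous. [folklore] -/
theorem continuous_ray_integrand {u : Space → ℝ} (hu : ContDiff ℝ 1 u) :
    Continuous fun p : Space × ℝ => fderiv ℝ u (p.2 • p.1) p.1 :=
  ((hu.continuous_fderiv one_ne_zero).comp (continuous_snd.smul continuous_fst)).clm_apply
    continuous_fst

/-- **Ray identity, integrated over the unit ball** (Fubini):
`∫_{B₁} (u(Sz) - u(εz)) dz = ∫_{ε < t ≤ S} ∫_{B₁} Du(tz)[z] dz dt`. [folklore] -/
theorem setIntegral_unitBall_sub_eq {u : Space → ℝ} (hu : ContDiff ℝ 1 u) {ε S : ℝ} (hεS : ε ≤ S) :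
    ∫ z in ball (0 : Space) 1, (u (S • z) - u (ε • z)) =
      ∫ t in Ioc ε S, ∫ z in ball (0 : Space) 1, fderiv ℝ u (t • z) z := by
  have h1 : ∀ z : Space, u (S • z) - u (ε • z) = ∫ t in Ioc ε S, fderiv ℝ u (t • z) z := fun z => by
    rw [sub_eq_integral_fderiv_smul hu z ε S, intervalIntegral.integral_of_le hεS]
  simp_rw [h1]
  -- Fubini on `B₁ × (ε, S]`
  have hcont := continuous_ray_integrand hu
  have hint : Integrable (uncurry fun (z : Space) (t : ℝ) => fderiv ℝ u (t • z) z)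
      ((volume.restrict (ball (0 : Space) 1)).prod (volume.restrict (Ioc ε S))) := by
    rw [Measure.prod_restrict]
    have hK : IsCompact (closedBall (0 : Space) 1 ×ˢ Icc ε S) :=
      (isCompact_closedBall 0 1).prod isCompact_Icc
    refine ((hcont.continuousOn.integrableOn_compact hK).mono_set ?_)
    exact prod_mono ball_subset_closedBall Ioc_subset_Icc_self
  exact integral_integral_swap hint

/-! ### The layer-cake formula for the truncated inverse-cube weight -/

/-- `∫_m^S 3t⁻⁴ dt = m⁻³ - S⁻³` for `0 < m ≤ S`. [folklore] -/
theorem integral_three_mul_inv_pow_four {m S : ℝ} (hm : 0 < m) (hmS : m ≤ S) :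
    ∫ t in Ioo m S, 3 * t⁻¹ ^ 4 = m⁻¹ ^ 3 - S⁻¹ ^ 3 := by
  rw [← integral_Ioc_eq_integral_Ioo, ← intervalIntegral.integral_of_le hmS]
  have hd : ∀ t ∈ uIcc m S, HasDerivAt (fun t : ℝ => -t⁻¹ ^ 3) (3 * t⁻¹ ^ 4) t := by
    intro t ht
    rw [uIcc_of_le hmS] at ht
    have ht0 : t ≠ 0 := (hm.trans_le ht.1).ne'
    have h := ((hasDerivAt_inv ht0).pow 3).neg
    refine h.congr_deriv ?_
    simp only [Nat.cast_ofNat, mul_neg, neg_neg]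
    rw [← inv_pow]
    ring
  have hc : ContinuousOn (fun t : ℝ => 3 * t⁻¹ ^ 4) (Icc m S) := by
    refine ContinuousOn.mul continuousOn_const ((continuousOn_inv₀.mono ?_).pow 4)
    intro t ht
    exact (hm.trans_le ht.1).ne'
  rw [intervalIntegral.integral_eq_sub_of_hasDerivAt hd (hc.intervalIntegrable_of_Icc hmS)]
  ring

/-- **Layer-cake representation of the truncated inverse-cube weight**: for continuous `F` and
`0 < ε ≤ S`,
`∫_{B_S} F(y) ((max ε |y|)⁻³ - S⁻³) dy = ∫_ε^S 3t⁻⁴ (∫_{B_t} F) dt`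
(write `(max ε |y|)⁻³ - S⁻³ = ∫_ε^S 3t⁻⁴ 1_{|y|<t} dt` and swap the integrals). [folklore] -/
theorem setIntegral_mul_truncWeight_eq {F : Space → ℝ} (hF : Continuous F) {ε S : ℝ} (hε : 0 < ε)
    (hεS : ε ≤ S) :
    ∫ y in ball (0 : Space) S, F y * ((max ε ‖y‖)⁻¹ ^ 3 - S⁻¹ ^ 3) =
      ∫ t in Ioo ε S, 3 * t⁻¹ ^ 4 * ∫ y in ball (0 : Space) t, F y := by
  -- a bound for `F` on the closed ball
  obtain ⟨C, hC⟩ := (isCompact_closedBall (0 : Space) S).exists_bound_of_continuousOn hF.continuousOn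
  have hC0 : 0 ≤ C := (norm_nonneg _).trans (hC 0 (mem_closedBall_self (hε.le.trans hεS)))
  -- the joint integrand
  set G : ℝ → Space → ℝ := fun t y => 3 * t⁻¹ ^ 4 * (if ‖y‖ < t then F y else 0) with hG
  -- Step 1: the right-hand side as an iterated integral of `G`
  have hR : ∀ t ∈ Ioo ε S, 3 * t⁻¹ ^ 4 * ∫ y in ball (0 : Space) t, F y =
      ∫ y in ball (0 : Space) S, G t y := by
    intro t ht
    rw [← integral_const_mul]
    have hsub : ball (0 : Space) t ⊆ ball 0 S := ball_subset_ball ht.2.le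
    have h1 : ∫ y in ball (0 : Space) S, G t y =
        ∫ y in ball (0 : Space) S, (ball (0 : Space) t).indicator (fun y => 3 * t⁻¹ ^ 4 * F y) y := by
      refine setIntegral_congr_fun measurableSet_ball fun y _ => ?_
      simp only [hG, indicator, mem_ball_zero_iff]
      split_ifs <;> simp
    rw [h1, setIntegral_indicator measurableSet_ball, inter_eq_self_of_subset_right hsub]
  -- Step 2: the left-hand side as the other iterated integral of `G`
  have hL : ∀ y ∈ ball (0 : Space) S, F y * ((max ε ‖y‖)⁻¹ ^ 3 - S⁻¹ ^ 3) =
      ∫ t in Ioo ε S, G t y := by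
    intro y hy
    rw [mem_ball_zero_iff] at hy
    have hm : 0 < max ε ‖y‖ := lt_max_of_lt_left hε
    have hmS : max ε ‖y‖ ≤ S := max_le hεS hy.le
    have h1 : ∫ t in Ioo ε S, G t y =
        ∫ t in Ioo ε S, (Ioi ‖y‖).indicator (fun t => 3 * t⁻¹ ^ 4 * F y) t := by
      refine setIntegral_congr_fun measurableSet_Ioo fun t _ => ?_
      simp only [hG, indicator, mem_Ioi]
      split_ifs <;> simp
    rw [h1, setIntegral_indicator measurableSet_Ioi, Ioo_inter_Ioi, integral_mul_const,
      integral_three_mul_inv_pow_four hm hmS, mul_comm]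
  rw [setIntegral_congr_fun measurableSet_ball hL, setIntegral_congr_fun measurableSet_Ioo hR]
  -- Step 3: Fubini
  have hmeas : Measurable (uncurry G) := by
    refine Measurable.mul (measurable_const.mul ((measurable_fst.inv).pow_const 4)) ?_
    exact Measurable.ite (measurableSet_lt (continuous_norm.measurable.comp measurable_snd)
      measurable_fst) (hF.measurable.comp measurable_snd) measurable_const
  have hint : Integrable (uncurry G) ((volume.restrict (Ioo ε S)).prod
      (volume.restrict (ball (0 : Space) S))) := by
    rw [Measure.prod_restrict]
    have hfin : (volume.prod volume) (Ioo ε S ×ˢ ball (0 : Space) S) ≠ ⊤ := by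
      rw [Measure.prod_prod]
      exact ENNReal.mul_ne_top measure_Ioo_lt_top.ne measure_ball_lt_top.ne
    refine Integrable.mono' (integrableOn_const (C := 3 * ε⁻¹ ^ 4 * C) (hs := hfin))
      hmeas.aestronglyMeasurable ?_
    filter_upwards [ae_restrict_mem (measurableSet_Ioo.prod measurableSet_ball)] with p hp
    obtain ⟨ht, hy⟩ := hp
    simp only [uncurry, hG]
    rw [norm_mul, norm_mul, Real.norm_of_nonneg (by norm_num : (0 : ℝ) ≤ 3), norm_pow, norm_inv,
      Real.norm_of_nonneg (hε.le.trans ht.1.le)]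
    have h1 : p.1⁻¹ ^ 4 ≤ ε⁻¹ ^ 4 :=
      pow_le_pow_left₀ (inv_nonneg.2 (hε.le.trans ht.1.le)) (inv_anti₀ hε ht.1.le) 4
    have h2 : ‖(if ‖p.2‖ < p.1 then F p.2 else 0)‖ ≤ C := by
      split_ifs
      · exact hC _ (ball_subset_closedBall hy)
      · simpa using hC0
    gcongr
  exact (integral_integral_swap hint).symm

/-! ### The dilation identity: `∫_{B_S} Du(y)[y]·((max ε |y|)⁻³ - S⁻³) dy` -/

/-- `∫_{B_t} Du(y)[y] dy = t⁴ ∫_{B₁} Du(tz)[z] dz`. [folklore] -/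
theorem setIntegral_ball_fderiv_apply_self {u : Space → ℝ} {t : ℝ} (ht : 0 < t) :
    ∫ y in ball (0 : Space) t, fderiv ℝ u y y = t ^ 4 * ∫ z in ball (0 : Space) 1, fderiv ℝ u (t • z) z := by
  have h := setIntegral_unitBall_comp_smul (fun y : Space => fderiv ℝ u y y) ht
  simp only [map_smul, smul_eq_mul] at h
  rw [integral_const_mul] at h
  have ht3 : (t ^ 3)⁻¹ ≠ 0 := inv_ne_zero (pow_ne_zero 3 ht.ne')
  calc ∫ y in ball (0 : Space) t, fderiv ℝ u y y
      = t ^ 3 * ((t ^ 3)⁻¹ * ∫ y in ball (0 : Space) t, fderiv ℝ u y y) := by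
        rw [← mul_assoc, mul_inv_cancel₀ (pow_ne_zero 3 ht.ne'), one_mul]
    _ = t ^ 3 * (t * ∫ z in ball (0 : Space) 1, fderiv ℝ u (t • z) z) := by rw [h]
    _ = t ^ 4 * ∫ z in ball (0 : Space) 1, fderiv ℝ u (t • z) z := by ring

/-- **The dilation identity**: for `u ∈ C¹(Space)` and `0 < ε ≤ S`,
`∫_{B_S} Du(y)[y] ((max ε |y|)⁻³ - S⁻³) dy = 3 (S⁻³ ∫_{B_S} u - ε⁻³ ∫_{B_ε} u)`
(layer cake, `∫_{B_t} Du(y)[y] dy = t⁴ ∫_{B₁} Du(tz)[z] dz`, and the fundamental theorem of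
calculus along rays). [folklore] -/
theorem setIntegral_fderiv_apply_self_mul_truncWeight {u : Space → ℝ} (hu : ContDiff ℝ 1 u)
    {ε S : ℝ} (hε : 0 < ε) (hεS : ε ≤ S) :
    ∫ y in ball (0 : Space) S, fderiv ℝ u y y * ((max ε ‖y‖)⁻¹ ^ 3 - S⁻¹ ^ 3) =
      3 * ((S ^ 3)⁻¹ * (∫ y in ball (0 : Space) S, u y) - (ε ^ 3)⁻¹ * (∫ y in ball (0 : Space) ε, u y)) := by
  have hS : 0 < S := hε.trans_le hεS
  have hEu : Continuous fun y : Space => fderiv ℝ u y y :=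
    (hu.continuous_fderiv one_ne_zero).clm_apply continuous_id
  rw [setIntegral_mul_truncWeight_eq hEu hε hεS]
  have h1 : ∀ t ∈ Ioo ε S, 3 * t⁻¹ ^ 4 * ∫ y in ball (0 : Space) t, fderiv ℝ u y y =
      3 * ∫ z in ball (0 : Space) 1, fderiv ℝ u (t • z) z := by
    intro t ht
    have ht0 : 0 < t := hε.trans ht.1
    rw [setIntegral_ball_fderiv_apply_self ht0, inv_pow, mul_assoc, ← mul_assoc ((t ^ 4)⁻¹),
      inv_mul_cancel₀ (pow_ne_zero 4 ht0.ne'), one_mul]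
  rw [setIntegral_congr_fun measurableSet_Ioo h1, integral_const_mul,
    ← integral_Ioc_eq_integral_Ioo, ← setIntegral_unitBall_sub_eq hu hεS]
  have hiS : IntegrableOn (fun z : Space => u (S • z)) (ball (0 : Space) 1) volume :=
    ((hu.continuous.comp (continuous_id.const_smul S)).continuousOn.integrableOn_compact
      (isCompact_closedBall 0 1)).mono_set ball_subset_closedBall
  have hiε : IntegrableOn (fun z : Space => u (ε • z)) (ball (0 : Space) 1) volume :=
    ((hu.continuous.comp (continuous_id.const_smul ε)).continuousOn.integrableOn_compact
      (isCompact_closedBall 0 1)).mono_set ball_subset_closedBall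
  rw [integral_sub hiS hiε, setIntegral_unitBall_comp_smul u hS, setIntegral_unitBall_comp_smul u hε]
  simp only [smul_eq_mul]

/-- The weight produced by Green's identity: `2(dubp ε - dubp S)(y) = -(4π)⁻¹((max ε |y|)⁻³ - S⁻³)`
on the ball `B_S`, and `0` off it. [folklore] -/
theorem two_mul_dubp_sub {ε S : ℝ} (hε : 0 < ε) (hεS : ε ≤ S) (y : Space) :
    2 * ((-(8 * Real.pi * (max ε ‖y‖) ^ 3)⁻¹) - (-(8 * Real.pi * (max S ‖y‖) ^ 3)⁻¹)) = (ball (0 : Space) S).indicator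
      (fun y => -(4 * Real.pi)⁻¹ * ((max ε ‖y‖)⁻¹ ^ 3 - S⁻¹ ^ 3)) y := by
  have hpi : Real.pi ≠ 0 := Real.pi_ne_zero
  by_cases hy : y ∈ ball (0 : Space) S
  · rw [indicator_of_mem hy]
    rw [mem_ball_zero_iff] at hy
    rw [max_eq_left hy.le]
    have h0 : max ε ‖y‖ ≠ 0 := (lt_max_of_lt_left hε).ne'
    have hS0 : S ≠ 0 := (hε.trans_le hεS).ne'
    rw [inv_pow, inv_pow]
    field_simp
    ring
  · rw [indicator_of_notMem hy]
    rw [mem_ball_zero_iff, not_lt] at hy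
    rw [max_eq_right (hεS.trans hy), max_eq_right hy]
    ring

/-- **Green's identity evaluated** (`♦`): for `u ∈ C²(Space)` and `0 < ε ≤ S`,
`∫ Δu · (N_ε - N_S) = (3/4π) (S⁻³ ∫_{B_S} u - ε⁻³ ∫_{B_ε} u) = ⨍_{B_S} u - ⨍_{B_ε} u`.
[cite: GilbargTrudinger2001, Thm 2.1] -/
theorem integral_laplacian_mul_testKernel_eq {ε S : ℝ} (hε : 0 < ε) (hεS : ε ≤ S) {u : Space → ℝ}
    (hu : ContDiff ℝ 2 u) :
    ∫ y, (Δ u) y * (((3 * (max ε ‖y‖) ^ 2 - ‖y‖ ^ 2) / (8 * Real.pi * (max ε ‖y‖) ^ 3)) - ((3 * (max S ‖y‖) ^ 2 - ‖y‖ ^ 2) / (8 * Real.pi * (max S ‖y‖) ^ 3))) =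
      3 / (4 * Real.pi) * ((S ^ 3)⁻¹ * (∫ y in ball (0 : Space) S, u y) -
        (ε ^ 3)⁻¹ * (∫ y in ball (0 : Space) ε, u y)) := by
  rw [integral_laplacian_mul_testKernel hε hεS hu]
  have h1 : ∀ y : Space, (2 * ((-(8 * Real.pi * (max ε ‖y‖) ^ 3)⁻¹) - (-(8 * Real.pi * (max S ‖y‖) ^ 3)⁻¹))) * fderiv ℝ u y y =
      (ball (0 : Space) S).indicator (fun y => -(4 * Real.pi)⁻¹ *
        (fderiv ℝ u y y * ((max ε ‖y‖)⁻¹ ^ 3 - S⁻¹ ^ 3))) y := by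
    intro y
    rw [two_mul_dubp_sub hε hεS y]
    by_cases hy : y ∈ ball (0 : Space) S
    · rw [indicator_of_mem hy, indicator_of_mem hy]; ring
    · rw [indicator_of_notMem hy, indicator_of_notMem hy, zero_mul]
  simp_rw [h1]
  rw [integral_indicator measurableSet_ball, integral_const_mul,
    setIntegral_fderiv_apply_self_mul_truncWeight (hu.of_le one_le_two) hε hεS]
  ring

end HarmonicMinorant

end Summit.AtomisticToContinuum.BoseEinsteinCondensation.Theorems
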